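import Summits.Ventures.Crystal3D.Theorems.StickyWulffConstantTextureLiminfTexShadowSplitDefsV5
import Summits.Ventures.Crystal3D.Theorems.StickyWulffConstantTextureLiminfTexShadowFaultedSameFrame
import HarnessLib

/-!
# T-F2 STATEMENT OF RECORD (cf-p1 DECISION (lxxx)(iii)): the F_layer law for the TWIN FAMILY of one frame, at explicit constants, and the split of `stub_famFaulted`

HONEST FRAMING. Venture `Summits/Ventures/Crystal3D` (cell `crystal3d-full`); DEFINITIONS + pure-logic glue for lane T's debt
T-F2 = `stub_famFaulted : (∃ C, BilayerWallFaultedOnReachCoaxialAt (13/25) C 10) ∧ (∃ C, BilayerWallFaultedZigCoaxialAt (13/25) C 10)`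
(TexShadow v7/v8, crux `TextureLiminfV5` stmt-Ventures-23912; owner 19481-p1).  Census-free, standard axioms; NOTHING about the
stubs is proved here; F-C1 not moved.  Sizing memo HOME/wall-19481-p1/T-F2-n3.md; cf-p1 (lxxx): «the named debt … is ACCEPTED as
T-F2's statement of record CONDITIONAL on (N)»; (N) numbers of record (19481-p1 g14, kit j322198/j322366): the JOINT basal row
(`EndRowJointA`, …CoaxialWallLawEndRowJointDefs) peaks at 922/315 = 2.93 ≪ 2√6 over all 20 class words with ≤ 2 vacancies.

* `InTwinFamily P A` — every bilayer lattice `A i '' Λ₀` is `P '' Λ₀` or its basal twin `(basalMirror ≫ P) '' Λ₀` (the per-plate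
  hypothesis of `frames_equal_or_coaxial_of_twinFamily`; a faulted plate of frame `P` satisfies it by
  `bilayerFrame_image_eq_frame_or_basalTwin`, an fcc plate co-axial with it about `P e₃` likewise);
* **`FLayerTwinFamilyAt c₀ C R₀`** — THE F_layer LAW: every pair of Barlow plates (any presentations, any Hägg words) whose bilayer
  frames lie in ONE twin family satisfies the wall-cell inequality for every `c₀`-admissible table at `(C, R₀)`.  Known sub-cases:
  basal axis (`bilayerWallAt_of_twinFamily_basal`, zero table); `BothFcc` (= lane F's `CoaxialTwoSlabAdhesionUnifAt` through
  `bilayerWallAt_of_coaxialCell`).  OPEN in general (= per-strip F ledger + the joint row, memo §3);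
* `BilayerWallFaultedOnReachOffFamilyAt` / `…ZigOffFamilyAt` — the REMAINDERS of the two `stub_famFaulted` classes outside every twin
  family (mixed strips: some facing bilayer pair is not co-axial about the plates' common axis);
* `faultedOnReachCoaxialAt_of_fLayer_offFamily`, `faultedZigCoaxialAt_of_fLayer_offFamily` — pure logic:
  `FLayerTwinFamilyAt c₀ C R₀ → …OffFamilyAt c₀ C R₀ → BilayerWallFaulted…CoaxialAt c₀ C R₀` (so T-F2 = F_layer ∪ off-family remainder,
  with the SAME constant).
WHAT THIS IS NOT: no proof of F_layer or of the remainders; F-C1 not moved.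
-/

noncomputable section

open scoped BigOperators InnerProductSpace ENNReal
open MeasureTheory

namespace Summit.Ventures.Crystal3D.Cruxes.TextureLiminf.TexShadow

open Summit.Ventures.Crystal3D Summit.Ventures.Crystal3D.Theorems
open Literature.MathematicalPhysics.StatisticalMechanics (IsHaggSeq basalMirror)

/-- **The plate's bilayer frames lie in the twin family of `P`**: every `A i '' Λ₀` is `P '' Λ₀` or `(basalMirror ≫ P) '' Λ₀`. -/
def InTwinFamily (P : E3 ≃ₗᵢ[ℝ] E3) (A : ℤ → (E3 ≃ₗᵢ[ℝ] E3)) : Prop :=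
  ∀ i : ℤ, A i '' fccRef = P '' fccRef ∨ A i '' fccRef = (basalMirror.trans P) '' fccRef

/-- **THE F_layer LAW FOR THE TWIN FAMILY, at cap `c₀` and constants `(C, R₀)`** (T-F2's statement of record, cf-p1 (lxxx)(iii)): two
Barlow plates whose bilayer frames lie in ONE twin family satisfy the wall-cell inequality for every `c₀`-admissible table. -/
def FLayerTwinFamilyAt (c₀ C R₀ : ℝ) : Prop :=
  ∀ (σ₁ σ₂ : ℤ → ℤ), IsHaggSeq σ₁ → IsHaggSeq σ₂ →
    ∀ (L₁ L₂ P : E3 ≃ₗᵢ[ℝ] E3) (s₁ s₂ : E3) (A₁ A₂ : ℤ → (E3 ≃ₗᵢ[ℝ] E3)) (u₁ u₂ : ℤ → E3),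
    BilayerFramesAt L₁ s₁ σ₁ A₁ u₁ → BilayerFramesAt L₂ s₂ σ₂ A₂ u₂ → InTwinFamily P A₁ → InTwinFamily P A₂ →
    ∀ (c : ℤ → ℤ → ℝ) (m : ℤ → ℤ → E3), BilayerChargeAdmissibleAt c₀ A₁ A₂ c m →
      BilayerWallAt C R₀ σ₁ σ₂ L₁ L₂ s₁ s₂ c

/-- **The corner-keyed faulted class OUTSIDE every twin family** (the mixed-strip remainder of T-F2's first half). -/
def BilayerWallFaultedOnReachOffFamilyAt (c₀ C R₀ : ℝ) : Prop :=
  ∀ (σ₁ σ₂ : ℤ → ℤ), IsHaggSeq σ₁ → IsHaggSeq σ₂ → ¬ BothFcc σ₁ σ₂ →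
    ∀ (L₁ L₂ : E3 ≃ₗᵢ[ℝ] E3) (s₁ s₂ : E3) (A₁ A₂ : ℤ → (E3 ≃ₗᵢ[ℝ] E3)) (u₁ u₂ : ℤ → E3),
    BilayerFramesAt L₁ s₁ σ₁ A₁ u₁ → BilayerFramesAt L₂ s₂ σ₂ A₂ u₂ →
    (¬ ∃ P : E3 ≃ₗᵢ[ℝ] E3, InTwinFamily P A₁ ∧ InTwinFamily P A₂) →
    (∀ i j : ℤ, ¬ InResidualClass (A₁ i) (A₂ j) (u₁ i) (u₂ j)) →
    ∀ (c : ℤ → ℤ → ℝ) (m : ℤ → ℤ → E3), BilayerChargeAdmissibleAt c₀ A₁ A₂ c m → DomBy L₁ σ₁ L₂ σ₂ c →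
      (∃ F₁ ∈ cornerFrames L₁ σ₁ e₃, ∃ F₂ ∈ cornerFrames L₂ σ₂ (-e₃), CoAxFrames F₁ F₂) →
      BilayerWallAt C R₀ σ₁ σ₂ L₁ L₂ s₁ s₂ c

/-- **The zig-keyed faulted class OUTSIDE every twin family** (the mixed-strip remainder of T-F2's second half). -/
def BilayerWallFaultedZigOffFamilyAt (c₀ C R₀ : ℝ) : Prop :=
  ∀ (σ₁ σ₂ : ℤ → ℤ), IsHaggSeq σ₁ → IsHaggSeq σ₂ → ¬ BothFcc σ₁ σ₂ →
    ∀ (L₁ L₂ : E3 ≃ₗᵢ[ℝ] E3) (s₁ s₂ : E3) (A₁ A₂ : ℤ → (E3 ≃ₗᵢ[ℝ] E3)) (u₁ u₂ : ℤ → E3),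
    BilayerFramesAt L₁ s₁ σ₁ A₁ u₁ → BilayerFramesAt L₂ s₂ σ₂ A₂ u₂ →
    (¬ ∃ P : E3 ≃ₗᵢ[ℝ] E3, InTwinFamily P A₁ ∧ InTwinFamily P A₂) →
    (∀ i j : ℤ, ¬ InResidualClass (A₁ i) (A₂ j) (u₁ i) (u₂ j)) →
    ∀ (c : ℤ → ℤ → ℝ) (m : ℤ → ℤ → E3), BilayerChargeAdmissibleAt c₀ A₁ A₂ c m →
      DeltaSteep L₁ e₃ → DeltaSteep L₂ (-e₃) → FluxDominated (Real.sqrt 2 / 2) L₁ σ₁ L₂ σ₂ c →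
      ¬ BarlowOffReach L₁ s₁ σ₁ L₂ s₂ σ₂ → ¬ RowMixDominated (Real.sqrt 2 / 2) L₁ σ₁ L₂ σ₂ c →
      ¬ (ZigGood L₁ σ₁ e₃ ∧ ZigGood L₂ σ₂ (-e₃)) →
      (∃ F₁ ∈ zigFrames L₁ e₃, ∃ F₂ ∈ zigFrames L₂ (-e₃), CoAxFrames F₁ F₂) →
      BilayerWallAt C R₀ σ₁ σ₂ L₁ L₂ s₁ s₂ c

/-- **T-F2, corner-keyed half = F_layer ∪ off-family remainder** (same constants; pure logic). -/
theorem faultedOnReachCoaxialAt_of_fLayer_offFamily {c₀ C R₀ : ℝ} (hF : FLayerTwinFamilyAt c₀ C R₀)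
    (hO : BilayerWallFaultedOnReachOffFamilyAt c₀ C R₀) : BilayerWallFaultedOnReachCoaxialAt c₀ C R₀ := by
  intro σ₁ σ₂ hσ₁ hσ₂ hnb L₁ L₂ s₁ s₂ A₁ A₂ u₁ u₂ hfr₁ hfr₂ hgen c m hadm hdom hco
  by_cases hfam : ∃ P : E3 ≃ₗᵢ[ℝ] E3, InTwinFamily P A₁ ∧ InTwinFamily P A₂
  · obtain ⟨P, h₁, h₂⟩ := hfam
    exact hF σ₁ σ₂ hσ₁ hσ₂ L₁ L₂ P s₁ s₂ A₁ A₂ u₁ u₂ hfr₁ hfr₂ h₁ h₂ c m hadm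
  · exact hO σ₁ σ₂ hσ₁ hσ₂ hnb L₁ L₂ s₁ s₂ A₁ A₂ u₁ u₂ hfr₁ hfr₂ hfam hgen c m hadm hdom hco

/-- **T-F2, zig-keyed half = F_layer ∪ off-family remainder** (same constants; pure logic). -/
theorem faultedZigCoaxialAt_of_fLayer_offFamily {c₀ C R₀ : ℝ} (hF : FLayerTwinFamilyAt c₀ C R₀)
    (hO : BilayerWallFaultedZigOffFamilyAt c₀ C R₀) : BilayerWallFaultedZigCoaxialAt c₀ C R₀ := by
  intro σ₁ σ₂ hσ₁ hσ₂ hnb L₁ L₂ s₁ s₂ A₁ A₂ u₁ u₂ hfr₁ hfr₂ hgen c m hadm hΔ₁ hΔ₂ hflux hoff hrow hzig hco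
  by_cases hfam : ∃ P : E3 ≃ₗᵢ[ℝ] E3, InTwinFamily P A₁ ∧ InTwinFamily P A₂
  · obtain ⟨P, h₁, h₂⟩ := hfam
    exact hF σ₁ σ₂ hσ₁ hσ₂ L₁ L₂ P s₁ s₂ A₁ A₂ u₁ u₂ hfr₁ hfr₂ h₁ h₂ c m hadm
  · exact hO σ₁ σ₂ hσ₁ hσ₂ hnb L₁ L₂ s₁ s₂ A₁ A₂ u₁ u₂ hfr₁ hfr₂ hfam hgen c m hadm hΔ₁ hΔ₂ hflux hoff hrow hzig hco

/-- `stub_famFaulted` from F_layer and the two off-family remainders, all at `(13/25, C, 10)`-type constants. -/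
theorem famFaultedAt_of_fLayer_offFamily {c₀ R₀ : ℝ} (hF : ∃ C, FLayerTwinFamilyAt c₀ C R₀)
    (hO₁ : ∃ C, BilayerWallFaultedOnReachOffFamilyAt c₀ C R₀) (hO₂ : ∃ C, BilayerWallFaultedZigOffFamilyAt c₀ C R₀)
    (hR₀ : 0 ≤ R₀) :
    (∃ C, BilayerWallFaultedOnReachCoaxialAt c₀ C R₀) ∧ (∃ C, BilayerWallFaultedZigCoaxialAt c₀ C R₀) := by
  obtain ⟨C, hC⟩ := hF
  obtain ⟨C₁, hC₁⟩ := hO₁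
  obtain ⟨C₂, hC₂⟩ := hO₂
  refine ⟨⟨max C C₁, faultedOnReachCoaxialAt_of_fLayer_offFamily ?_ ?_⟩, ⟨max C C₂, faultedZigCoaxialAt_of_fLayer_offFamily ?_ ?_⟩⟩
  · exact fun σ₁ σ₂ hσ₁ hσ₂ L₁ L₂ P s₁ s₂ A₁ A₂ u₁ u₂ hfr₁ hfr₂ h₁ h₂ c m hadm =>
      bilayerWallAt_mono hR₀ (le_max_left _ _) (hC σ₁ σ₂ hσ₁ hσ₂ L₁ L₂ P s₁ s₂ A₁ A₂ u₁ u₂ hfr₁ hfr₂ h₁ h₂ c m hadm)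
  · exact fun σ₁ σ₂ hσ₁ hσ₂ hnb L₁ L₂ s₁ s₂ A₁ A₂ u₁ u₂ hfr₁ hfr₂ hfam hgen c m hadm hdom hco =>
      bilayerWallAt_mono hR₀ (le_max_right _ _) (hC₁ σ₁ σ₂ hσ₁ hσ₂ hnb L₁ L₂ s₁ s₂ A₁ A₂ u₁ u₂ hfr₁ hfr₂ hfam hgen c m hadm hdom hco)
  · exact fun σ₁ σ₂ hσ₁ hσ₂ L₁ L₂ P s₁ s₂ A₁ A₂ u₁ u₂ hfr₁ hfr₂ h₁ h₂ c m hadm =>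
      bilayerWallAt_mono hR₀ (le_max_left _ _) (hC σ₁ σ₂ hσ₁ hσ₂ L₁ L₂ P s₁ s₂ A₁ A₂ u₁ u₂ hfr₁ hfr₂ h₁ h₂ c m hadm)
  · exact fun σ₁ σ₂ hσ₁ hσ₂ hnb L₁ L₂ s₁ s₂ A₁ A₂ u₁ u₂ hfr₁ hfr₂ hfam hgen c m hadm hΔ₁ hΔ₂ hflux hoff hrow hzig hco =>
      bilayerWallAt_mono hR₀ (le_max_right _ _)
        (hC₂ σ₁ σ₂ hσ₁ hσ₂ hnb L₁ L₂ s₁ s₂ A₁ A₂ u₁ u₂ hfr₁ hfr₂ hfam hgen c m hadm hΔ₁ hΔ₂ hflux hoff hrow hzig hco)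

/-- **The basal twin family is already settled** (any cap `c₀ ≤ 1`): the zero table pays. -/
theorem fLayerTwinFamily_basal {c₀ : ℝ} (hc₀ : c₀ ≤ 1) {σ₁ σ₂ : ℤ → ℤ} (hσ₁ : IsHaggSeq σ₁) (hσ₂ : IsHaggSeq σ₂)
    (L₁ L₂ : E3 ≃ₗᵢ[ℝ] E3) {P : E3 ≃ₗᵢ[ℝ] E3} (s₁ s₂ : E3) {A₁ A₂ : ℤ → (E3 ≃ₗᵢ[ℝ] E3)}
    (h₁ : InTwinFamily P A₁) (h₂ : InTwinFamily P A₂) {c : ℤ → ℤ → ℝ} {m : ℤ → ℤ → E3}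
    (hadm : BilayerChargeAdmissibleAt c₀ A₁ A₂ c m) (hbasal : ⟪P e₃, e₃⟫_ℝ ^ 2 = 1) (R₀ : ℝ) (hR₀ : 3 ≤ R₀) :
    BilayerWallAt ((3456 + 1152 * (R₀ + 1)) / 2) R₀ σ₁ σ₂ L₁ L₂ s₁ s₂ c :=
  bilayerWallAt_of_twinFamily_basal hσ₁ hσ₂ L₁ L₂ s₁ s₂ h₁ h₂ (bilayerChargeAdmissible_of_at hc₀ hadm) hbasal R₀ hR₀

end Summit.Ventures.Crystal3D.Cruxes.TextureLiminf.TexShadow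

end
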